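import Mathlib.Tactic
import HarnessLib

/-!
# Kozma–Nitzan's Question 8 at three relays — the ZERO-MASS EXPANSION of the C2 class vector (gen 21)

Support file (`--supports stmt-CriticalPhenomena-4575`, closed crux; independent mathematics on Kozma–Nitzan's Question 8,
arXiv:2401.12397 §5.5 p. 36), prover `prim-ineq-gen-6` (gen 21).  No definitions, no named facts, no sorries; standard axioms.
Memo `run/shared/lean/prim/prim-ineq-gen-6/FINDING-G21.md` §3–§4.

For one pendant block with in-moments `π, ε, m` (`Φ = π + ε − m`, `σ = π + m`, `D = ε − m`, `c = D(πΦ − m)/Φ`,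
`κ₀ = c − (Φ+m)(1−Φ)`) the (V₂) class vector at the corner C2 has components, in the basis `(1, α̂, γ̂, μ̂ | κ)` of class functions,
`θ₀ = (Φσ, −(Φσ−c), −(Φ+m−c), Φ+m−2c | κ₀)`.  Its total `λ̃`-mass `v₁ + ε v_α + π v_γ + m v_μ + m v_κ` vanishes
(`c2_classVector_zeroMass`), and in the basis of the zero-mass space
`n₁ = (Φ,−1,−1,1|0)` [(K-a)], `n₂ = (π,0,−1,0|0)` [(K-c)], `n₃ = (ε,−1,0,0|0)` [(K-ε)], `r₀ = (0,0,0,1|−1)` [K₀ ≼ K₁]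
its coordinates are `(X, (Φ+m)(1−Φ), −ΦD, −κ₀)` with `X = (Φ+m)Φ − c = Φσ + D² + Dm/Φ ≥ 0`
(`c2_X_eq`, `c2_X_nonneg`, `c2_classVector_expand`).  After folding the root `a` of `T = a –s– T₁` (root parameters `A, C`) the class vector on
`T₁` is `θ₁ = (sΦσ, −s(Φσ−c)A + g, −s(Φ+m−c)C + g, s(Φ+m−2c)AC − 2g | sκ₀AC + g)` and its coordinates are
`(sAC·X − g, sC·Z, sA·Y, −(sACκ₀ + g))` with `Y = (Φσ − c) − C·X`, `Z = (Φ+m−c) − A·X` (`c2_foldVector_expand`); `Z ≥ 0` (`c2_Z_nonneg`).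
These identities carry the inductive proof of C2 for path-end blocks (memo §4).  [cite: KozmaNitzan2024, Question 8 (§5.5 p. 36)]
-/

namespace Summit.CriticalPhenomena.PercolationContinuityZ3.Theorems

namespace PocketCert

/-- **Zero mass of the C2 class vector.**  With `Φ = π + ε − m`, `σ = π + m`, `D = ε − m` and `c·Φ = D(πΦ − m)`, the vector
`(Φσ, −(Φσ−c), −(Φ+m−c), Φ+m−2c | c − (Φ+m)(1−Φ))` has `λ̃`-mass `v₁ + ε v_α + π v_γ + m v_μ + m v_κ = 0` (this is `E_ω G₀ = 0`).
[cite: KozmaNitzan2024, Question 8 (§5.5 p. 36)] -/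
theorem c2_classVector_zeroMass (π ε m c : ℝ) (hc : c * (π + ε - m) = (ε - m) * (π * (π + ε - m) - m)) :
    let Φ := π + ε - m
    let σ := π + m
    (Φ * σ) + ε * (-(Φ * σ - c)) + π * (-(Φ + m - c)) + m * (Φ + m - 2 * c) + m * (c - (Φ + m) * (1 - Φ)) = 0 := by
  intro Φ σ
  simp only [Φ, σ]
  linear_combination hc

/-- **`X = (Φ+m)Φ − c = Φσ + D² + Dm/Φ`** when `c = D(πΦ − m)/Φ`, `D = ε − m`, `Φ = π + ε − m ≠ 0`, `σ = π + m`.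
[cite: KozmaNitzan2024, Question 8 (§5.5 p. 36)] -/
theorem c2_X_eq (π ε m : ℝ) (hΦ : π + ε - m ≠ 0) :
    let Φ := π + ε - m
    let D := ε - m
    (Φ + m) * Φ - D * (π * Φ - m) / Φ = Φ * (π + m) + D ^ 2 + D * m / Φ := by
  intro Φ D
  have h : Φ ≠ 0 := hΦ
  field_simp
  ring

/-- **`X ≥ 0`**: `Φ(π+m) + D² + Dm/Φ ≥ 0` for `Φ > 0`, `π, m ≥ 0`, `D ≥ 0`.  [cite: KozmaNitzan2024, Question 8 (§5.5 p. 36)] -/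
theorem c2_X_nonneg (Φ π m D : ℝ) (hΦ : 0 < Φ) (hπ : 0 ≤ π) (hm : 0 ≤ m) (hD : 0 ≤ D) :
    0 ≤ Φ * (π + m) + D ^ 2 + D * m / Φ := by
  positivity

/-- **Zero-mass expansion of the C2 class vector** (componentwise, in the basis `(1, α̂, γ̂, μ̂ | κ)`):
`θ₀ = X·n₁ + (Φ+m)(1−Φ)·n₂ − ΦD·n₃ + |κ₀|·r₀` with `n₁ = (Φ,−1,−1,1|0)`, `n₂ = (π,0,−1,0|0)`, `n₃ = (ε,−1,0,0|0)`,
`r₀ = (0,0,0,1|−1)`, `X = (Φ+m)Φ − c`, `κ₀ = c − (Φ+m)(1−Φ)`, `D = ε − m` (here `|κ₀| = −κ₀`; no sign is claimed); the first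
component is the zero-mass constraint and needs `c·Φ = D(πΦ − m)`.
[cite: KozmaNitzan2024, Question 8 (§5.5 p. 36)] -/
theorem c2_classVector_expand (π ε m c : ℝ) (hc : c * (π + ε - m) = (ε - m) * (π * (π + ε - m) - m)) :
    let Φ := π + ε - m
    let σ := π + m
    let D := ε - m
    let X := (Φ + m) * Φ - c
    let Z₀ := (Φ + m) * (1 - Φ)
    let κ₀ := c - (Φ + m) * (1 - Φ)
    -- components (1, α̂, γ̂, μ̂ | κ) of X n₁ + Z₀ n₂ − ΦD n₃ + (−κ₀) r₀
    (Φ * σ = X * Φ + Z₀ * π + (-(Φ * D)) * ε) ∧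
    (-(Φ * σ - c) = X * (-1) + (-(Φ * D)) * (-1)) ∧
    (-(Φ + m - c) = X * (-1) + Z₀ * (-1)) ∧
    (Φ + m - 2 * c = X * 1 + (-κ₀) * 1) ∧
    (κ₀ = (-κ₀) * (-1)) := by
  intro Φ σ D X Z₀ κ₀
  simp only [Φ, σ, D, X, Z₀, κ₀]
  refine ⟨by linear_combination hc, by ring, by ring, by ring, by ring⟩

/-- **Zero-mass expansion of the folded vector.**  After folding the root `a` (edge weight `s`, root parameters `A`, `C`,
`g = (1−s)G₀({a})/Φ₁`), `θ₁ = (sΦσ, −s(Φσ−c)A + g, −s(Φ+m−c)C + g, s(Φ+m−2c)AC − 2g | sκ₀AC + g)` equals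
`(sAC·X − g)·n₁ + sC·Z·n₂ + sA·Y·n₃ + (−(sACκ₀ + g))·r₀` componentwise, where `Y = (Φσ−c) − C·X`, `Z = (Φ+m−c) − A·X`
(T's constants; basis vectors `n₁ = (Φ₁,−1,−1,1|0)`, `n₂ = (π₁,0,−1,0|0)`, `n₃ = (ε₁,−1,0,0|0)`, `r₀` of the sub-block `T₁`;
the first component is the zero-mass constraint and is taken as hypothesis `hmass`).  [cite: KozmaNitzan2024, Question 8 (§5.5 p. 36)] -/
theorem c2_foldVector_expand (Φ σ m c κ₀ s A C g Φ₁ π₁ ε₁ : ℝ)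
    (hmass : s * Φ * σ = (s * A * C * ((Φ + m) * Φ - c) - g) * Φ₁ + (s * C * ((Φ + m - c) - A * ((Φ + m) * Φ - c))) * π₁
              + (s * A * ((Φ * σ - c) - C * ((Φ + m) * Φ - c))) * ε₁)
    (hκ : κ₀ = c - (Φ + m) * (1 - Φ)) :
    let X := (Φ + m) * Φ - c
    let Y := (Φ * σ - c) - C * X
    let Z := (Φ + m - c) - A * X
    let ν₁ := s * A * C * X - g
    let ν₂ := s * C * Z
    let ν₃ := s * A * Y
    let ν₀ := -(s * κ₀ * A * C + g)
    (s * Φ * σ = ν₁ * Φ₁ + ν₂ * π₁ + ν₃ * ε₁) ∧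
    (-(s * (Φ * σ - c) * A) + g = ν₁ * (-1) + ν₃ * (-1)) ∧
    (-(s * (Φ + m - c) * C) + g = ν₁ * (-1) + ν₂ * (-1)) ∧
    (s * (Φ + m - 2 * c) * A * C - 2 * g = ν₁ * 1 + ν₀ * 1) ∧
    (s * κ₀ * A * C + g = ν₀ * (-1)) := by
  intro X Y Z ν₁ ν₂ ν₃ ν₀
  simp only [X, Y, Z, ν₁, ν₂, ν₃, ν₀]
  refine ⟨?_, by ring, by ring, ?_, by ring⟩
  · simpa [mul_comm, mul_left_comm, mul_assoc] using hmass
  · rw [hκ]; ring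

/-- **`Z ≥ 0`**: with `X = (Φ+m)Φ − c ≥ 0`, `Z = (Φ+m−c) − A·X = (Φ+m)(1−Φ) + (1−A)X ≥ 0` for `Φ ≤ 1`, `Φ+m ≥ 0`, `A ≤ 1`.
[cite: KozmaNitzan2024, Question 8 (§5.5 p. 36)] -/
theorem c2_Z_nonneg (Φ m c A : ℝ) (hX : 0 ≤ (Φ + m) * Φ - c) (hΦ : Φ ≤ 1) (hΦm : 0 ≤ Φ + m) (hA : A ≤ 1) :
    0 ≤ (Φ + m - c) - A * ((Φ + m) * Φ - c) := by
  have h : (Φ + m - c) - A * ((Φ + m) * Φ - c) = (Φ + m) * (1 - Φ) + (1 - A) * ((Φ + m) * Φ - c) := by ring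
  rw [h]
  have h1 : 0 ≤ (Φ + m) * (1 - Φ) := mul_nonneg hΦm (by linarith)
  have h2 : 0 ≤ (1 - A) * ((Φ + m) * Φ - c) := mul_nonneg (by linarith) hX
  linarith

/-- **`Y = (1−C)·X − Φ·D`** (with `X = (Φ+m)Φ − c`, `D = ε − m`, `σ = π + m`, `Φ = π + ε − m`): the `n₃`-coordinate is indefinite in general and
equals `−ΦD ≤ 0` for the unscaled block (`C = 1`).  [cite: KozmaNitzan2024, Question 8 (§5.5 p. 36)] -/
theorem c2_Y_eq (π ε m c C : ℝ) :
    let Φ := π + ε - m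
    let σ := π + m
    let D := ε - m
    let X := (Φ + m) * Φ - c
    (Φ * σ - c) - C * X = (1 - C) * X - Φ * D := by
  intro Φ σ D X
  simp only [Φ, σ, D, X]
  ring

end PocketCert

end Summit.CriticalPhenomena.PercolationContinuityZ3.Theorems
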